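import Summits.CriticalPhenomena.PercolationContinuityZ3.Theorems.PercNearOneGluingNoHeavyLowerTailSunflowerDoublyCompletingKernelB
import Summits.CriticalPhenomena.PercolationContinuityZ3.Theorems.PercNearOneGluingNoHeavyLowerTailSunflowerTwoPointCompleting
import HarnessLib

/-!
# `NoHeavyLowerTail` (crux stmt-CriticalPhenomena-4575), abstract sunflower cubic: ★ (`0 ≤ ZH`) behind a DOUBLY COMPLETING PAIR

Support file (seat `prim-ineq-gen-2` gen 25; `--supports stmt-CriticalPhenomena-4575`).  No `sorry`, no named facts; nothing is asserted about
the crux.  Assembly of the kernel checks `…DoublyCompletingKernelA/B`; companion of `…TwoPointCompleting` (whose row lemmas it reuses).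
Memo: run/shared/lean/prim/prim-ineq-gen-2/TWO-POINT-GEN25.md.

THEOREM `Sunflower.ZH_nonneg_of_doublyCompleting` (this work; a new unconditional class of the typed conjecture `PartitionLemmaH` = ★):
if two points `p ≠ q` BOTH complete every petal set `X` avoiding them (`lab X ∉ {0,⊤}`, `p, q ∉ X` ⟹ `lab (X+p) = ⊤` and `lab (X+q) = ⊤`), then
`0 ≤ ZH`.  Sets containing `p` or `q` are unconstrained — in particular flat OR-twins `lab (X+p) = lab (X+q) = lab (X+p+q) = k` over a bottom `X`
are allowed (they are excluded by the two-point completing class `ZH_nonneg_of_twoPointCompleting`, which in exchange constrains only the `p`-lift).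
Neither point need be petal-completing in the one-point sense of `…OnePointCertificates` (`X + q` may stay a petal under `p`).  On gen 24's corpus
of 504 six-point sunflowers without a good coordinate this is the second class of the greedy two-point cover (kit j168163).

PROOF (architecture of `…SunflowerPiercedPair`).  Nested split of the ordered 3-partitions along `p` and `q`; the block data of a block avoiding
`p, q` takes 42 values (`dcCode`, `exists_dcCode`); subtract six weighted antipodal-Gladkov rows on the window `E' ∖ X` (offsets `(∅,∅)`, `({p},{p})`,
`({q},{q})`, `({p,q},{p})`, `({p,q},{q})`, `({p,q},{p,q})`; the new row shape is `nested_weight_mul_kk_insert_insert_insert_nonneg`) from TWICE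
the nine-placement kernel and symmetrise: the symmetrised doubled kernel is nonnegative on every code triple (`dcKer_symm_nonneg`).
-/

namespace Summit.CriticalPhenomena.PercolationContinuityZ3.Theorems.SunflowerPartition

open Finset

/-- **Finite kernel check**: the symmetrised doubled kernel is nonnegative on all `42³` code triples. [this work] -/
theorem dcKer_symm_nonneg (a b c : Fin 42) : 0 ≤ symm6Of dcKer (dcCode a) (dcCode b) (dcCode c) := by
  have S := dcKer_symm_nonneg_sorted
  have P12 := fun x y z : Fin 42 => symm6Of_swap12 dcKer (dcCode x) (dcCode y) (dcCode z)
  have P23 := fun x y z : Fin 42 => symm6Of_swap23 dcKer (dcCode x) (dcCode y) (dcCode z)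
  rcases le_total a b with hab | hba <;> rcases le_total b c with hbc | hcb <;> rcases le_total a c with hac | hca
  · exact S a b c hab hbc
  · exact S a b c hab hbc
  · rw [P23]; exact S a c b hac hcb
  · rw [P23, P12]; exact S c a b hca hab
  · rw [P12]; exact S b a c hba hac
  · rw [P12, P23]; exact S b c a hbc hca
  · rw [P12, P23, P12]; exact S c b a hcb hba
  · rw [P12, P23, P12]; exact S c b a hcb hba

/-- Every admissible block-data quadruple — diamond monotonicity along the four inclusions, a petal `x` forces `xp = ⊤` and `xq = ⊤` (a Boolean
test, decided by enumeration) — is one of the 42 codes. [this work] -/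
theorem exists_dcCode_of : ∀ x xp xq xpq : Fin 5,
    ((x = xp || x = 0 || xp = 4) && (x = xq || x = 0 || xq = 4) && (xp = xpq || xp = 0 || xpq = 4) && (xq = xpq || xq = 0 || xpq = 4) &&
      (x = 0 || x = 4 || xp = 4) && (x = 0 || x = 4 || xq = 4)) = true → ∃ c : Fin 42, dcCode c = (x, xp, xq, xpq) := by
  decide

variable {α : Type*} [DecidableEq α]

namespace Sunflower

variable (F : Sunflower α)

/-- Polarised rows `kk (lab (S+p+q)) (lab (T+e))` for `e ∈ {p,q}` with a nonnegative weight of the first block are nonnegative (polarised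
antipodal Gladkov with offsets `{p,q} ⊇ {e}` on every complement cube). [this work] -/
theorem nested_weight_mul_kk_insert_insert_insert_nonneg (W : Finset α) (p q e : α) (he : e = p ∨ e = q) (w : Finset α → ℤ)
    (hw : ∀ X, 0 ≤ w X) :
    0 ≤ nested W (fun X S T => w X * kk (F.lab (insert p (insert q S))) (F.lab (insert e T))) := by
  unfold nested
  refine sum_nonneg fun X _ => ?_
  rw [← mul_sum]
  refine mul_nonneg (hw X) ?_
  have hsub : ({e} : Finset α) ⊆ {p, q} := by
    rw [singleton_subset_iff, mem_insert, mem_singleton]; exact he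
  have h := F.antipodal_gladkov_polarized (W \ X) {p, q} {e} hsub
  refine le_of_le_of_eq h (sum_congr rfl fun S _ => ?_)
  rw [insert_union, ← insert_eq, ← insert_eq]

/-- Behind a doubly completing pair, the block data of a set avoiding `p, q` is one of the 42 codes. [this work] -/
theorem exists_dcCode {p q : α}
    (h : ∀ X : Finset α, p ∉ X → q ∉ X → F.lab X ≠ 0 → F.lab X ≠ 4 → F.lab (insert p X) = 4 ∧ F.lab (insert q X) = 4)
    {X : Finset α} (hp : p ∉ X) (hq : q ∉ X) : ∃ c : Fin 42, dcCode c = F.blockData p q X := by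
  unfold blockData
  have m1 := F.lab_mono (subset_insert p X)
  have m2 := F.lab_mono (subset_insert q X)
  have m3 := F.lab_mono (insert_subset_insert p (subset_insert q X))
  have m4 := F.lab_mono (subset_insert p (insert q X))
  have c1 := or_of_completes _ _ (fun h0 h4 => (h X hp hq h0 h4).1)
  have c2 := or_of_completes _ _ (fun h0 h4 => (h X hp hq h0 h4).2)
  refine exists_dcCode_of _ _ _ _ ?_
  simp only [Bool.and_eq_true, Bool.or_eq_true, decide_eq_true_eq, or_assoc]
  exact ⟨⟨⟨⟨⟨m1, m2⟩, m3⟩, m4⟩, c1⟩, c2⟩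

/-- **★ BEHIND A DOUBLY COMPLETING PAIR**: if `p ≠ q` and every petal set `X` avoiding `p, q` has `lab (X+p) = ⊤` and `lab (X+q) = ⊤`, then
`0 ≤ ZH`. [this work] -/
theorem ZH_nonneg_of_doublyCompleting [Fintype α] {p q : α} (hpq : p ≠ q)
    (h : ∀ X : Finset α, p ∉ X → q ∉ X → F.lab X ≠ 0 → F.lab X ≠ 4 → F.lab (insert p X) = 4 ∧ F.lab (insert q X) = 4) : 0 ≤ F.ZH := by
  set E' : Finset α := univ \ {p, q} with hE'
  have hpE : p ∉ E' := fun hh => (mem_sdiff.1 hh).2 (mem_insert_self _ _)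
  have hqE : q ∉ E' := fun hh => (mem_sdiff.1 hh).2 (mem_insert_of_mem (mem_singleton_self _))
  have hpW : p ∉ insert q E' := fun hh => by
    rcases mem_insert.1 hh with hh | hh
    · exact hpq hh
    · exact hpE hh
  have huniv : (univ : Finset α) = insert p (insert q E') := by
    ext x
    simp only [mem_univ, mem_insert, hE', mem_sdiff, mem_singleton, true_and, true_iff]
    tauto
  set G : Finset α → Finset α → Finset α → ℤ := fun X S T => s6H (F.lab X) (F.lab S) (F.lab T) with hG
  set L : Finset α → BlockData := F.blockData p q with hL
  -- twice ZH as a nested sum on `insert p (insert q E')`, split along `p` and `q`: the doubled kernel plus the six rows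
  have hsplit : 2 * nested (insert p (insert q E')) G
      = nested E' (fun X S T => dcKer (L X) (L S) (L T))
        + (nested E' (fun X S T => dcW00 (L X) * kk (F.lab S) (F.lab T))
          + nested E' (fun X S T => dcW11 (L X) * kk (F.lab (insert p S)) (F.lab (insert p T)))
          + nested E' (fun X S T => dcW22 (L X) * kk (F.lab (insert q S)) (F.lab (insert q T)))
          + nested E' (fun X S T => dcW31 (L X) * kk (F.lab (insert p (insert q S))) (F.lab (insert p T)))
          + nested E' (fun X S T => dcW32 (L X) * kk (F.lab (insert p (insert q S))) (F.lab (insert q T)))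
          + nested E' (fun X S T => dcW33 (L X) * kk (F.lab (insert p (insert q S))) (F.lab (insert p (insert q T))))) := by
    rw [nested_insert_split _ p hpW, nested_insert_split _ q hqE, nested_insert_split _ q hqE, nested_insert_split _ q hqE]
    unfold nested
    simp only [hG, hL, blockData, dcKer, nineH, sum_add_distrib, sum_sub_distrib, two_mul]
    ring
  have hker : 0 ≤ nested E' (fun X S T => dcKer (L X) (L S) (L T)) := by
    have h6 := six_mul_nested_eq_symm6Of E' L dcKer
    have hpos : 0 ≤ nested E' (fun X S T => symm6Of dcKer (L X) (L S) (L T)) := by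
      refine nested_nonneg_of_forall E' _ fun X hX S hS => ?_
      have hT : (E' \ X) \ S ⊆ E' := sdiff_subset.trans sdiff_subset
      have hS' : S ⊆ E' := hS.trans sdiff_subset
      obtain ⟨a, ha⟩ := F.exists_dcCode h (fun hh => hpE (hX hh)) (fun hh => hqE (hX hh))
      obtain ⟨b, hb⟩ := F.exists_dcCode h (fun hh => hpE (hS' hh)) (fun hh => hqE (hS' hh))
      obtain ⟨c, hc⟩ := F.exists_dcCode h (fun hh => hpE (hT hh)) (fun hh => hqE (hT hh))
      rw [hL, ← ha, ← hb, ← hc]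
      exact dcKer_symm_nonneg a b c
    linarith
  have hrow0 : 0 ≤ nested E' (fun X S T => dcW00 (L X) * kk (F.lab S) (F.lab T)) :=
    F.nested_weight_mul_kk_nonneg E' (fun X => dcW00 (L X)) fun X => dcW00_nonneg _
  have hrow1 : 0 ≤ nested E' (fun X S T => dcW11 (L X) * kk (F.lab (insert p S)) (F.lab (insert p T))) :=
    F.nested_weight_mul_kk_insert_nonneg E' p (fun X => dcW11 (L X)) fun X => dcW11_nonneg _
  have hrow2 : 0 ≤ nested E' (fun X S T => dcW22 (L X) * kk (F.lab (insert q S)) (F.lab (insert q T))) :=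
    F.nested_weight_mul_kk_insert_nonneg E' q (fun X => dcW22 (L X)) fun X => dcW22_nonneg _
  have hrow3 : 0 ≤ nested E' (fun X S T => dcW31 (L X) * kk (F.lab (insert p (insert q S))) (F.lab (insert p T))) :=
    F.nested_weight_mul_kk_insert_insert_insert_nonneg E' p q p (Or.inl rfl) (fun X => dcW31 (L X)) fun X => dcW31_nonneg _
  have hrow4 : 0 ≤ nested E' (fun X S T => dcW32 (L X) * kk (F.lab (insert p (insert q S))) (F.lab (insert q T))) :=
    F.nested_weight_mul_kk_insert_insert_insert_nonneg E' p q q (Or.inr rfl) (fun X => dcW32 (L X)) fun X => dcW32_nonneg _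
  have hrow5 : 0 ≤ nested E' (fun X S T => dcW33 (L X) * kk (F.lab (insert p (insert q S))) (F.lab (insert p (insert q T)))) :=
    F.nested_weight_mul_kk_insert_insert_nonneg E' p q (fun X => dcW33 (L X)) fun X => dcW33_nonneg _
  have hZ : F.ZH = nested (insert p (insert q E')) G := by
    unfold ZH
    rw [sum_parts_eq_nested_univ (fun X S T => s6H (F.lab X) (F.lab S) (F.lab T)), huniv]
  have h2 : 0 ≤ 2 * F.ZH := by rw [hZ, hsplit]; linarith
  linarith

/-- Both orders at once: a pair of distinct points each completing every petal set avoiding both (stated with the points in either order). [this work] -/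
theorem ZH_nonneg_of_doublyCompleting' [Fintype α] {p q : α} (hpq : p ≠ q)
    (hp : ∀ X : Finset α, p ∉ X → q ∉ X → F.lab X ≠ 0 → F.lab X ≠ 4 → F.lab (insert p X) = 4)
    (hq : ∀ X : Finset α, p ∉ X → q ∉ X → F.lab X ≠ 0 → F.lab X ≠ 4 → F.lab (insert q X) = 4) : 0 ≤ F.ZH :=
  F.ZH_nonneg_of_doublyCompleting hpq fun X h1 h2 h3 h4 => ⟨hp X h1 h2 h3 h4, hq X h1 h2 h3 h4⟩

end Sunflower

end Summit.CriticalPhenomena.PercolationContinuityZ3.Theorems.SunflowerPartition
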